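import Summits.QuantumFields.YangMills.Theorems.ColdStartUniversalityLatticeLangevinDossSussmannSmoothingFlat
import Literature.Analysis.ODE.PathDrivenSecondOrder
import HarnessLib

/-!
# Route `ColdStartUniversality` (fixed-cut-off SZZ dynamics; Doss–Sussmann smoothing programme, file 7):
# SECOND-ORDER BOUNDS — a tamed field with bounded second derivative, and `‖D²Φ‖` UNIFORM in the Brownian path

Helper file (seat `ym-line-csu-p1`, g24).  Towards `P_t(C²) ⊂ C²`:
* `exists_tamed_dossSussmannField₂` — the bump-tamed Doss–Sussmann field of file 1 with, in addition, a uniform bound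
  `‖D²G(p, M)‖ ≤ K` over frames `‖p‖ ≤ 1` (same compactness argument, one derivative higher);
* ★ `exists_dossSussmannFlow₂` — the global flow of file 2 with, in addition, the SECOND-derivative bound
  `‖D²(x ↦ Φ x τ)(x₀)‖ ≤ exp((TK + TK·e^{TK}) τ)`, INDEPENDENT of the driving path (tree:
  `Literature.Analysis.ODE.norm_fderiv_fderiv_pathDriven_le`, the jet-system Grönwall, g24).
THEOREMS ONLY, no sorry.  HONEST FRAMING: fixed-cut-off plumbing; nothing K-uniform; no crux, rung or summit statement is
proved; the Yang–Mills mass gap is NOT proved.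
-/

set_option autoImplicit false

noncomputable section

namespace Summit.QuantumFields.YangMills.Theorems.ColdStartUniversality

open MeasureTheory Finset Filter Set Metric Function unitInterval
open scoped NNReal Matrix Topology
open Literature.MathematicalPhysics.QuantumFieldTheory Literature.Analysis.ODE
open Literature.MathematicalPhysics.QuantumLattice (fundamentalRep fundamentalLatticeRep continuous_fundamentalRep
  fundamentalRep_mem_unitaryGroup)

variable {L : ℕ}

/-- **Uniform bounds from compact support in the second variable.**  A continuous function on
(frame, configuration) pairs which vanishes identically near every point with `‖M‖ > 2` is bounded on `{‖p‖ ≤ 1}`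
(compactness of `closedBall 0 1 × closedBall 0 2` in finite dimension). [folklore] -/
theorem exists_bound_of_vanishing_far [NeZero L] {X : Type*} [SeminormedAddCommGroup X]
    {H : (Edge 3 L → Fin (fundamentalLatticeRep 2).N → Fin (fundamentalLatticeRep 2).N → ℂ) ×
        (Edge 3 L → Fin (fundamentalLatticeRep 2).N → Fin (fundamentalLatticeRep 2).N → ℂ) → X}
    (hc : Continuous H) (h0 : ∀ q, 2 < ‖q.2‖ → H q = 0) :
    ∃ C : ℝ, 0 ≤ C ∧ ∀ p M, ‖p‖ ≤ 1 → ‖H (p, M)‖ ≤ C := by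
  let Cfg : Type := Edge 3 L → Fin (fundamentalLatticeRep 2).N → Fin (fundamentalLatticeRep 2).N → ℂ
  have hS : IsCompact (closedBall (0 : Cfg) 1 ×ˢ closedBall (0 : Cfg) 2) :=
    (isCompact_closedBall _ _).prod (isCompact_closedBall _ _)
  obtain ⟨C, hC⟩ := hS.exists_bound_of_continuousOn (f := H) hc.continuousOn
  refine ⟨max C 0, le_max_right _ _, fun p M hp => ?_⟩
  by_cases hM : ‖M‖ ≤ 2
  · exact (hC (p, M) ⟨mem_closedBall_zero_iff.2 hp, mem_closedBall_zero_iff.2 hM⟩).trans (le_max_left _ _)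
  · rw [h0 (p, M) (lt_of_not_ge hM), norm_zero]; exact le_max_right _ _

/-- **The bump-tamed Doss–Sussmann field and its support property**: `C^∞`, equal to the raw field on `‖M‖ ≤ 1`,
identically zero near every point with `‖M‖ > 2`. [folklore] -/
theorem exists_tamed_dossSussmannField_vanishing [NeZero L] (β : ℝ) :
    ∃ G : (Edge 3 L → Fin (fundamentalLatticeRep 2).N → Fin (fundamentalLatticeRep 2).N → ℂ) ×
        (Edge 3 L → Fin (fundamentalLatticeRep 2).N → Fin (fundamentalLatticeRep 2).N → ℂ) →
        (Edge 3 L → Fin (fundamentalLatticeRep 2).N → Fin (fundamentalLatticeRep 2).N → ℂ),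
      ContDiff ℝ (⊤ : ℕ∞) G ∧
      (∀ p M, ‖M‖ ≤ 1 → G (p, M) = fun (e : Edge 3 L) (k l : Fin (fundamentalLatticeRep 2).N) =>
        ((Matrix.of (p e))ᴴ *
          (fundamentalLatticeRep 2).driftLie β (fun e' => Matrix.of (p e') * Matrix.of (M e')) e *
          (Matrix.of (p e) * Matrix.of (M e))) k l) ∧
      (∀ q, 2 < ‖q.2‖ → G =ᶠ[𝓝 q] fun _ => 0) := by
  let Cfg : Type := Edge 3 L → Fin (fundamentalLatticeRep 2).N → Fin (fundamentalLatticeRep 2).N → ℂ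
  let F : Cfg × Cfg → Cfg := fun q e k l =>
    ((Matrix.of (q.1 e))ᴴ *
      (fundamentalLatticeRep 2).driftLie β (fun e' => Matrix.of (q.1 e') * Matrix.of (q.2 e')) e *
      (Matrix.of (q.1 e) * Matrix.of (q.2 e))) k l
  have hF : ∀ {n : WithTop ℕ∞}, ContDiff ℝ n F := fun {n} => contDiff_dossSussmannField (L := L) β
  obtain ⟨χ, hχ1, hχ2⟩ : ∃ χ : ContDiffBump (0 : Cfg), χ.rIn = 1 ∧ χ.rOut = 2 :=
    ⟨⟨1, 2, one_pos, one_lt_two⟩, rfl, rfl⟩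
  have hχ : ∀ {n : ℕ∞}, ContDiff ℝ n (χ : Cfg → ℝ) := fun {n} => χ.contDiff
  have hG : ∀ {n : ℕ∞}, ContDiff ℝ n (fun q : Cfg × Cfg => (χ : Cfg → ℝ) q.2 • F q) := fun {n} =>
    ((hχ (n := n)).comp contDiff_snd).smul (hF (n := n))
  refine ⟨fun q => (χ : Cfg → ℝ) q.2 • F q, hG, fun p M hM => ?_, fun q hq => ?_⟩
  · have hM' : M ∈ closedBall (0 : Cfg) χ.rIn := by
      rw [hχ1, mem_closedBall_zero_iff]; exact hM
    have h1 : (χ : Cfg → ℝ) M = 1 := χ.one_of_mem_closedBall hM'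
    show (χ : Cfg → ℝ) M • F (p, M) = _
    rw [h1, one_smul]
  · have hopen : IsOpen {q' : Cfg × Cfg | 2 < ‖q'.2‖} := isOpen_lt continuous_const (continuous_norm.comp continuous_snd)
    filter_upwards [hopen.mem_nhds hq] with q' hq'
    have hd : χ.rOut ≤ dist q'.2 0 := by rw [hχ2, dist_zero_right]; exact hq'.le
    have h0 : (χ : Cfg → ℝ) q'.2 = 0 := χ.zero_of_le_dist hd
    show (χ : Cfg → ℝ) q'.2 • F q' = 0
    rw [h0, zero_smul]

/-- ★ **Tamed Doss–Sussmann field with second-derivative bound.**  As `exists_tamed_dossSussmannField`, with additionally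
`‖D²G(p, M)‖ ≤ K` for all frames `‖p‖ ≤ 1` and all `M`. [folklore] -/
theorem exists_tamed_dossSussmannField₂ [NeZero L] (β : ℝ) :
    ∃ G : (Edge 3 L → Fin (fundamentalLatticeRep 2).N → Fin (fundamentalLatticeRep 2).N → ℂ) ×
        (Edge 3 L → Fin (fundamentalLatticeRep 2).N → Fin (fundamentalLatticeRep 2).N → ℂ) →
        (Edge 3 L → Fin (fundamentalLatticeRep 2).N → Fin (fundamentalLatticeRep 2).N → ℂ),
      ContDiff ℝ (⊤ : ℕ∞) G ∧
      (∀ p M, ‖M‖ ≤ 1 → G (p, M) = fun (e : Edge 3 L) (k l : Fin (fundamentalLatticeRep 2).N) =>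
        ((Matrix.of (p e))ᴴ *
          (fundamentalLatticeRep 2).driftLie β (fun e' => Matrix.of (p e') * Matrix.of (M e')) e *
          (Matrix.of (p e) * Matrix.of (M e))) k l) ∧
      ∃ K : ℝ≥0,
        (∀ p M, ‖p‖ ≤ 1 → ‖G (p, M)‖ ≤ K) ∧
        (∀ p M, ‖p‖ ≤ 1 → ‖fderiv ℝ G (p, M)‖ ≤ K) ∧
        (∀ p, ‖p‖ ≤ 1 → LipschitzWith K fun M => G (p, M)) ∧
        (∀ p M, ‖p‖ ≤ 1 → ‖fderiv ℝ (fderiv ℝ G) (p, M)‖ ≤ K) := by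
  let Cfg : Type := Edge 3 L → Fin (fundamentalLatticeRep 2).N → Fin (fundamentalLatticeRep 2).N → ℂ
  obtain ⟨G, hG, hGF, hG0⟩ := exists_tamed_dossSussmannField_vanishing (L := L) β
  have hG2 : ContDiff ℝ 2 G := contDiff_infty.1 hG 2
  have hG1 : ContDiff ℝ 1 G := contDiff_infty.1 hG 1
  have hGd : Differentiable ℝ G := hG1.differentiable one_ne_zero
  have hGc' : Continuous (fderiv ℝ G) := hG1.continuous_fderiv one_ne_zero
  have hG'1 : ContDiff ℝ 1 (fderiv ℝ G) := hG2.fderiv_right (m := 1) le_rfl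
  have hGc'' : Continuous (fderiv ℝ (fderiv ℝ G)) := hG'1.continuous_fderiv one_ne_zero
  -- vanishing of `G`, `DG`, `D²G` far out
  have h0 : ∀ q : Cfg × Cfg, 2 < ‖q.2‖ → G q = 0 := fun q hq => (hG0 q hq).self_of_nhds
  have hG0' : ∀ q : Cfg × Cfg, 2 < ‖q.2‖ → fderiv ℝ G =ᶠ[𝓝 q] fun _ => 0 := fun q hq => by
    have hopen : IsOpen {q' : Cfg × Cfg | 2 < ‖q'.2‖} := isOpen_lt continuous_const (continuous_norm.comp continuous_snd)
    filter_upwards [hopen.mem_nhds hq] with q' hq'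
    rw [(hG0 q' hq').fderiv_eq (𝕜 := ℝ), fderiv_const_apply]
  have h1 : ∀ q : Cfg × Cfg, 2 < ‖q.2‖ → fderiv ℝ G q = 0 := fun q hq => (hG0' q hq).self_of_nhds
  have h2 : ∀ q : Cfg × Cfg, 2 < ‖q.2‖ → fderiv ℝ (fderiv ℝ G) q = 0 := fun q hq => by
    rw [(hG0' q hq).fderiv_eq (𝕜 := ℝ), fderiv_const_apply]
  obtain ⟨C₀, hC₀0, hC₀⟩ := exists_bound_of_vanishing_far (L := L) (H := G) hG.continuous h0
  obtain ⟨C₁, hC₁0, hC₁⟩ := exists_bound_of_vanishing_far (L := L) (H := fderiv ℝ G) hGc' h1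
  obtain ⟨C₂, hC₂0, hC₂⟩ := exists_bound_of_vanishing_far (L := L) (H := fderiv ℝ (fderiv ℝ G)) hGc'' h2
  let K : ℝ≥0 := ⟨C₀ + C₁ + C₂, by positivity⟩
  have hKc : (K : ℝ) = C₀ + C₁ + C₂ := rfl
  have hKC₀ : C₀ ≤ (K : ℝ) := by rw [hKc]; linarith
  have hKC₁ : C₁ ≤ (K : ℝ) := by rw [hKc]; linarith
  have hKC₂ : C₂ ≤ (K : ℝ) := by rw [hKc]; linarith
  have hbound1 : ∀ p M, ‖p‖ ≤ 1 → ‖fderiv ℝ G (p, M)‖ ≤ K := fun p M hp => (hC₁ p M hp).trans hKC₁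
  -- Lipschitz in `M` for every admissible frame
  have hlip : ∀ p, ‖p‖ ≤ 1 → LipschitzWith K fun M => G (p, M) := by
    intro p hp
    have hd : ∀ M, HasFDerivAt (fun M => G (p, M))
        ((fderiv ℝ G (p, M)).comp (ContinuousLinearMap.inr ℝ Cfg Cfg)) M :=
      fun M => (hGd (p, M)).hasFDerivAt.comp M (hasFDerivAt_prodMk_right (𝕜 := ℝ) p M)
    refine lipschitzWith_of_nnnorm_fderiv_le (fun M => (hd M).differentiableAt) fun M => ?_
    rw [(hd M).fderiv]
    have h : ‖(fderiv ℝ G (p, M)).comp (ContinuousLinearMap.inr ℝ Cfg Cfg)‖ ≤ K :=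
      (ContinuousLinearMap.opNorm_comp_le _ _).trans
        ((mul_le_of_le_one_right (norm_nonneg _) (ContinuousLinearMap.norm_inr_le_one ℝ Cfg Cfg)).trans
          (hbound1 p M hp))
    rw [← NNReal.coe_le_coe, coe_nnnorm]
    exact h
  exact ⟨G, hG, hGF, K, fun p M hp => (hC₀ p M hp).trans hKC₀, hbound1, hlip,
    fun p M hp => (hC₂ p M hp).trans hKC₂⟩

/-- ★ **The Doss–Sussmann flow with second-derivative bound.**  As `exists_dossSussmannFlow` (tamed field `G` with
constant `K`, now also bounding `‖D²G‖`; `T ≥ 0`; continuous frame path `c` with `‖c(τ)‖ ≤ 1`), with additionally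
`‖D²(x ↦ Φ x τ)(x₀)‖ ≤ exp((TK + TK·e^{TK}) τ)` for all `x₀`, `τ` — INDEPENDENT of the path `c` (jet-system Grönwall,
`Literature.Analysis.ODE.norm_fderiv_fderiv_pathDriven_le`). [folklore] -/
theorem exists_dossSussmannFlow₂ [NeZero L]
    {G : (Edge 3 L → Fin (fundamentalLatticeRep 2).N → Fin (fundamentalLatticeRep 2).N → ℂ) ×
        (Edge 3 L → Fin (fundamentalLatticeRep 2).N → Fin (fundamentalLatticeRep 2).N → ℂ) →
        (Edge 3 L → Fin (fundamentalLatticeRep 2).N → Fin (fundamentalLatticeRep 2).N → ℂ)}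
    {K : ℝ≥0} (hG : ContDiff ℝ (⊤ : ℕ∞) G) (hK0 : ∀ p M, ‖p‖ ≤ 1 → ‖G (p, M)‖ ≤ K)
    (hK1 : ∀ p M, ‖p‖ ≤ 1 → ‖fderiv ℝ G (p, M)‖ ≤ K) (hK2 : ∀ p, ‖p‖ ≤ 1 → LipschitzWith K fun M => G (p, M))
    (hK3 : ∀ p M, ‖p‖ ≤ 1 → ‖fderiv ℝ (fderiv ℝ G) (p, M)‖ ≤ K)
    {T : ℝ} (hT : 0 ≤ T)
    (c : C(I, Edge 3 L → Fin (fundamentalLatticeRep 2).N → Fin (fundamentalLatticeRep 2).N → ℂ))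
    (hc : ∀ τ, ‖c τ‖ ≤ 1) :
    ∃ Φ : (Edge 3 L → Fin (fundamentalLatticeRep 2).N → Fin (fundamentalLatticeRep 2).N → ℂ) →
        C(I, Edge 3 L → Fin (fundamentalLatticeRep 2).N → Fin (fundamentalLatticeRep 2).N → ℂ),
      (∀ x (τ : I), Φ x τ = x + ∫ s in (0:ℝ)..(τ:ℝ),
        T • G (IccExtend zero_le_one c s, IccExtend zero_le_one (Φ x) s)) ∧
      (∀ x (α : C(I, Edge 3 L → Fin (fundamentalLatticeRep 2).N → Fin (fundamentalLatticeRep 2).N → ℂ)),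
        (∀ τ : I, α τ = x + ∫ s in (0:ℝ)..(τ:ℝ),
          T • G (IccExtend zero_le_one c s, IccExtend zero_le_one α s)) → α = Φ x) ∧
      ContDiff ℝ (⊤ : ℕ∞) Φ ∧
      (∀ x₀ (τ : I), ‖fderiv ℝ (fun x => Φ x τ) x₀‖ ≤ Real.exp (T * K * τ)) ∧
      (∀ x (τ : I), ‖Φ x τ - x‖ ≤ T * K * τ) ∧
      (∀ x₀ (τ : I), ‖fderiv ℝ (fderiv ℝ (fun x => Φ x τ)) x₀‖ ≤
        Real.exp ((T * K + T * K * Real.exp (T * K)) * τ)) := by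
  let Cfg : Type := Edge 3 L → Fin (fundamentalLatticeRep 2).N → Fin (fundamentalLatticeRep 2).N → ℂ
  obtain ⟨Φ, hΦ, huniq, hs, hd1, hdisp⟩ := exists_dossSussmannFlow hG hK0 hK1 hK2 hT c hc
  refine ⟨Φ, hΦ, huniq, hs, hd1, hdisp, fun x₀ τ => ?_⟩
  -- the rescaled field and its first two derivatives
  let GT : Cfg × Cfg → Cfg := fun q => T • G q
  have hGT : ContDiff ℝ (⊤ : ℕ∞) GT := hG.const_smul T
  have hGT2 : ContDiff ℝ ((1 + 1 : ℕ∞) : WithTop ℕ∞) GT := (contDiff_infty.1 hGT 2).of_le (by norm_num)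
  have hGd : Differentiable ℝ G := hG.differentiable (by simp)
  have hG2 : ContDiff ℝ 2 G := contDiff_infty.1 hG 2
  have hG'd : Differentiable ℝ (fderiv ℝ G) := (hG2.fderiv_right (m := 1) le_rfl).differentiable one_ne_zero
  have hfd1 : ∀ q, fderiv ℝ GT q = T • fderiv ℝ G q := fun q => fderiv_const_smul (hGd q) T
  have hfd1' : fderiv ℝ GT = fun q => T • fderiv ℝ G q := funext hfd1
  have hfd2 : ∀ q, fderiv ℝ (fderiv ℝ GT) q = T • fderiv ℝ (fderiv ℝ G) q := fun q => by
    rw [hfd1']; exact fderiv_const_smul (hG'd q) T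
  have hA : 0 ≤ T * K := mul_nonneg hT K.2
  have hb₁ : ∀ (s : I) (u : Cfg), ‖fderiv ℝ GT (c s, Φ x₀ s) ((0 : Cfg), u)‖ ≤ T * K * ‖u‖ := by
    intro s u
    rw [hfd1]
    change ‖T • (fderiv ℝ G (c s, Φ x₀ s) ((0 : Cfg), u))‖ ≤ _
    rw [norm_smul, Real.norm_eq_abs, abs_of_nonneg hT, mul_assoc]
    refine mul_le_mul_of_nonneg_left ?_ hT
    calc ‖fderiv ℝ G (c s, Φ x₀ s) ((0 : Cfg), u)‖
        ≤ ‖fderiv ℝ G (c s, Φ x₀ s)‖ * ‖((0 : Cfg), u)‖ := ContinuousLinearMap.le_opNorm _ _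
      _ ≤ K * ‖u‖ := by
          have h0 : ‖((0 : Cfg), u)‖ ≤ ‖u‖ := by simp [Prod.norm_def]
          exact mul_le_mul (hK1 _ _ (hc s)) h0 (norm_nonneg _) K.2
  have hb₂ : ∀ (s : I) (u u' : Cfg),
      ‖fderiv ℝ (fderiv ℝ GT) (c s, Φ x₀ s) ((0 : Cfg), u) ((0 : Cfg), u')‖ ≤ T * K * ‖u‖ * ‖u'‖ := by
    intro s u u'
    rw [hfd2]
    change ‖T • (fderiv ℝ (fderiv ℝ G) (c s, Φ x₀ s) ((0 : Cfg), u) ((0 : Cfg), u'))‖ ≤ _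
    rw [norm_smul, Real.norm_eq_abs, abs_of_nonneg hT, mul_assoc, mul_assoc]
    refine mul_le_mul_of_nonneg_left ?_ hT
    have h0 : ‖((0 : Cfg), u)‖ ≤ ‖u‖ := by simp [Prod.norm_def]
    have h0' : ‖((0 : Cfg), u')‖ ≤ ‖u'‖ := by simp [Prod.norm_def]
    calc ‖fderiv ℝ (fderiv ℝ G) (c s, Φ x₀ s) ((0 : Cfg), u) ((0 : Cfg), u')‖
        ≤ ‖fderiv ℝ (fderiv ℝ G) (c s, Φ x₀ s) ((0 : Cfg), u)‖ * ‖((0 : Cfg), u')‖ :=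
          ContinuousLinearMap.le_opNorm _ _
      _ ≤ (‖fderiv ℝ (fderiv ℝ G) (c s, Φ x₀ s)‖ * ‖((0 : Cfg), u)‖) * ‖((0 : Cfg), u')‖ :=
          mul_le_mul_of_nonneg_right (ContinuousLinearMap.le_opNorm _ _) (norm_nonneg _)
      _ ≤ (K * ‖u‖) * ‖u'‖ :=
          mul_le_mul (mul_le_mul (hK3 _ _ (hc s)) h0 (norm_nonneg _) K.2) h0' (norm_nonneg _)
            (mul_nonneg K.2 (norm_nonneg _))
      _ = K * (‖u‖ * ‖u'‖) := by ring
  have h := norm_fderiv_fderiv_pathDriven_le (n := 1) hGT2 le_rfl c hΦ huniq x₀ hA hA hb₁ hb₂ τ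
  refine h.trans (le_of_eq ?_)
  ring_nf

end Summit.QuantumFields.YangMills.Theorems.ColdStartUniversality

end
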